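import Summits.QuantumFields.BalabanUV.T4Continuum.Support.NE9LinSizeEntropy
import Summits.QuantumFields.BalabanUV.T4Continuum.Support.NE9PrintedMajorantDecay

/-!
# NE9LinSizePinned — the LIP SIDE of the NE9 END faces in Bałaban's d-currency: the pinned coefficient sums (1.26) from decay
IN THE LINEAR SIZE with a κ-free constant above an additive threshold (no `e^{a}`), and the torus END faces E2′ / E5″ with the
scale bound so discharged (cell `pub-balaban`, T4-DAG §2 node U3 / §6 NE9; repair item NE9-F8 «d-currency dischargers» PART 2,
STAGE B-i; unit `b2b-balaban-t4-ne9-formalise-leaf-10`, gen 2)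

HONEST FRAMING (T4-DAG PAGE 1).  Rung (B)+1 on a FIXED finite torus — NOT infinite volume, NOT a mass gap, NOT the Clay problem.
NE9 is a cell NEW ESTIMATE, NOT PRINTED, and is NOT discharged here; every analytic input stays a DISPLAYED binder; [I]/[II] are
quoted for TYPES only (ABSOLUTE RULE); `FlowStep.BetaPertH`, (B), (B^μ) do not occur.  HONEST DEPENDENCY (verbatim): continuum YM
on T⁴ ⇐ BetaPertH ∧ nine spine estimates (0/9 proved); BetaPertH ⇐ (D1) ∧ (D4) ∧ CAP+tail; G-an2-4 gates asym, D1 and NE2/3/4.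

WHY (journal finding F-ne9leaf01-1, loss (P), first half).  The torus END faces E2
`T4HistoryLipschitzLinearSize.torus_ne9_and_fadingMemory_of_linSizeDecay` and E5 `NE9PrintedMajorantDecay.torus_ne9_and_fadingMemory_of_printedDecay`
display the (L‴) decay of the coefficient tables IN THE LINEAR SIZE, `‖c_ω(Y)‖ ≤ α₄(k)·e^{−a·d(dom Y)}` (TYPE: the (2.20) summand
«+ Σ_{Y∈𝐃} α₄exp(−δκd_k(Y))» of [II] p. 16), but discharge the pinned sums (1.26) in CUBE-COUNT currency
(`T4HistoryLipschitzSegment.pin_of_domainDecay` after `domainDecay_of_linSizeDecay`: `e^{−a·d} ≤ e^{a}·(e^{−a/2^ν})^{#cubes}`), so the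
Lipschitz scale must satisfy `α₄(k)·e^{a}·θ₁ ≤ lip k` with `e^{−a/2^ν}·e^{Dθ₁} ≤ θ₁` — the factor `e^{a}` (`a ↔ δκ`) then sits in
`lipbar` and hence in the fading product `4·lipbar·B·τ̄`.  Print's (1.26) p. 8 «Σ_{X∈𝐃_j, X⊃□′} exp(−κd_j(X)) ≤ O(1), (1.26) for κ
sufficiently large» has NO such factor.  NE9-F8 part 1a (`NE9LinSizeEntropy.sum_exp_neg_mul_linSize_le_const`, another seat)
proves exactly this shape in the kernel: a κ-FREE constant `2^(ν+1+2^ν)` above the ADDITIVE threshold `κ ≥ 2^ν·log 2 + log(8ν)`.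
This module feeds it into the lip side.

WHAT IS PROVED (kernel; `[folklore]` bookkeeping + the composition BY NAME; 0 `def`, 0 sorry).
§1 `pinnedSum_le_of_linSizeDecay` — weights `w Y ≤ αc·e^{−a·d(dom Y)}` on injectively labelled domains that are wall-connected
   when nonempty: at every cube `x`, `Σ_{Y : x ∈ dom Y} w Y ≤ αc·2^(ν+1+2^ν)` for `a ≥ 2^ν·log 2 + log(8ν)` (any coordinate group
   `G`; = `T4HistoryLipschitzSegment.pinnedSum_le_of_domainDecay` with the entropy step done in d-currency).
§2 `pin_of_linSizeDecay` — (L‴) in the linear size ⇒ the pinned scale bound (L″) of `cubeChart_ne9_and_fadingMemory_of_pinned`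
   under `αc k·2^(ν+1+2^ν) ≤ lip k` — NO `e^{a}`, no `θ₁`.
§3 `torus_ne9_and_fadingMemory_of_linSizeDecay_pinnedLin` (E2′) — E2 with `hθ₁ : e^{−a/2^ν}·e^{Dθ₁} ≤ θ₁` and
   `hliplb : α₄(k)·e^{a}·θ₁ ≤ lip k` REPLACED by `ha : 2^ν·log 2 + log(8ν) ≤ a` and `hliplb : α₄(k)·2^(ν+1+2^ν) ≤ lip k`; every
   other binder and the conclusion VERBATIM (∘ `cubeChart_ne9_and_fadingMemory_of_pinned` BY NAME).
§4 `torus_ne9_and_fadingMemory_of_printedDecay_pinnedLin` (E5″) — E5 (both activity-side decays in d-currency) with the same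
   replacement (∘ §3 + `NE9PrintedMajorantDecay.boxMajorantDecay_of_linSizeDecay` BY NAME).  The KP side of E5″ is STILL the
   cube-count one (`hθ`, `hεθ`, `hκd : κ ≤ d₁`: the rate division (R) of F-ne9leaf01-1 remains) — removing it is stage B-ii
   (`NE9LinSizeEnd`, on NE9-F8 part 1b).
DISGUISE TEST.  (L‴)/(1.26) are ONE-history statements about coefficient tables and lattice geometry; not NE9 in disguise.

References (TYPES only): [Balaban1988RG2Cluster] T. Bałaban, CMP 116 (1988) (1.26) p. 8, (1.36) p. 9, (2.18)–(2.20) p. 16, p. 17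
text, (2.29)–(2.30) p. 18, Lemma 3 (2.38) p. 20, (2.41) p. 21; [Balaban1987RG1] CMP 109 (1987) (0.23) p. 256, (0.26) p. 257, p. 257,
(1.18) p. 263; [KoteckyPreiss1986] CMP 103 (1986) (1)–(3); [FriedliVelenik2017] Lemma 3.38.
-/

noncomputable section

namespace Summit.QuantumFields.BalabanUV.T4Continuum.NE9LinSizePinned

open scoped BigOperators
open Metric Set MeasureTheory BoundedContinuousFunction
open Literature.Probability.LatticeModels
open Literature.MathematicalPhysics.QuantumFieldTheory
open Literature.MathematicalPhysics.QuantumFieldTheory.Balaban1983to89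
open Literature.MathematicalPhysics.QuantumFieldTheory.Balaban1983to89.T4OutputRate
open Literature.MathematicalPhysics.QuantumFieldTheory.Balaban1983to89.T4ActivityLipschitz
open Literature.MathematicalPhysics.QuantumFieldTheory.Balaban1983to89.T4HistoryLipschitzRecursion
open Literature.MathematicalPhysics.QuantumFieldTheory.Balaban1983to89.T4HistoryLipschitzOuter
open Literature.MathematicalPhysics.QuantumFieldTheory.Balaban1983to89.T4HistoryLipschitzActivity
open Literature.MathematicalPhysics.QuantumFieldTheory.Balaban1983to89.T4HistoryLipschitzEntropy
open Literature.MathematicalPhysics.QuantumFieldTheory.Balaban1983to89.T4HistoryLipschitzCubeGeometry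
open Literature.MathematicalPhysics.QuantumFieldTheory.Balaban1983to89.T4HistoryLipschitzActivity (ClusterGeom)
open Literature.MathematicalPhysics.QuantumFieldTheory.Balaban1983to89.T4HistoryLipschitzSegment
open Literature.MathematicalPhysics.QuantumFieldTheory.Balaban1983to89.T4HistoryLipschitzLinearSize
open Summit.QuantumFields.BalabanUV.T4Continuum.NE9LinSizeEntropy
open Summit.QuantumFields.BalabanUV.T4Continuum.NE9PrintedMajorantDecay

/-! ## §1 The pinned sum (1.26) from decay in the linear size: κ-free constant, additive threshold -/

section Pinned

variable {ν : ℕ} {G : Type*} [AddCommGroup G] [One G] [DecidableEq G] {F : Type*} [Fintype F]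

/-- **THE PINNED SUM (1.26) FROM DECAY IN THE LINEAR SIZE (kernel).**  Weights `w Y ≤ αc·e^{−a·d(dom Y)}` indexed by a finite
type, every NONEMPTY domain wall-connected ([I] p. 257 «two consecutive cubes have a common wall»), the domain map INJECTIVE on the
nonempty domains, and `a ≥ 2^ν·log 2 + log(8ν)`: at every cube `x`, `Σ_{Y : x ∈ dom Y} w Y ≤ αc·2^(ν+1+2^ν)` — the TYPE of [II]
(1.26) p. 8 «Σ_{X∈𝐃_j, X⊃□′} exp(−κd_j(X)) ≤ O(1), (1.26) for κ sufficiently large» with print's `d_j` in its lattice-edge form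
`linSize` and NO prefactor `e^{a}` (compare `T4HistoryLipschitzSegment.pinnedSum_le_of_domainDecay`, cube-count currency).  Proof:
the domains through `x` inject into the cube families inside the union of all domains that contain `x` and have a lattice
skeleton (`isSkeleton_self_of_isConn`); then `NE9LinSizeEntropy.sum_exp_neg_mul_linSize_le_const`.
[cite: Balaban1988RG2Cluster, (1.26) p.8; Balaban1987RG1, (0.26) p.257 and p.257] -/
theorem pinnedSum_le_of_linSizeDecay {w : F → ℝ} {dom : F → Finset (Fin ν → G)} {αc a : ℝ} (hαc : 0 ≤ αc)
    (ha : (2:ℝ) ^ ν * Real.log 2 + Real.log (8 * ν) ≤ a)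
    (hw : ∀ Y, w Y ≤ αc * Real.exp (-(a * (linSize (dom Y) : ℝ))))
    (hconn : ∀ Y, (dom Y).Nonempty → ∃ b ∈ dom Y, Polymer.IsConn WallAdj (dom Y) b)
    (hinj : Set.InjOn dom {Y | (dom Y).Nonempty}) (x : Fin ν → G) :
    ∑ Y ∈ Finset.univ.filter (fun Y => x ∈ dom Y), w Y ≤ αc * 2 ^ (ν + 1 + 2 ^ ν) := by
  classical
  calc ∑ Y ∈ Finset.univ.filter (fun Y => x ∈ dom Y), w Y
      ≤ ∑ Y ∈ Finset.univ.filter (fun Y => x ∈ dom Y), αc * Real.exp (-(a * (linSize (dom Y) : ℝ))) :=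
        Finset.sum_le_sum fun Y _ => hw Y
    _ = ∑ X ∈ (Finset.univ.filter (fun Y => x ∈ dom Y)).image dom, αc * Real.exp (-(a * (linSize X : ℝ))) := by
        rw [Finset.sum_image]
        exact fun Y₁ h₁ Y₂ h₂ he => hinj ⟨x, (Finset.mem_filter.1 h₁).2⟩ ⟨x, (Finset.mem_filter.1 h₂).2⟩ he
    _ ≤ ∑ X ∈ (Finset.univ.biUnion dom).powerset.filter (fun X => x ∈ X ∧ ∃ S, IsSkeleton X S),
          αc * Real.exp (-(a * (linSize X : ℝ))) := by
        refine Finset.sum_le_sum_of_subset_of_nonneg ?_ fun X _ _ => mul_nonneg hαc (Real.exp_nonneg _)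
        intro X hX
        obtain ⟨Y, hY, rfl⟩ := Finset.mem_image.1 hX
        have hxY : x ∈ dom Y := (Finset.mem_filter.1 hY).2
        obtain ⟨b, -, hb⟩ := hconn Y ⟨x, hxY⟩
        exact Finset.mem_filter.2 ⟨Finset.mem_powerset.2 (Finset.subset_biUnion_of_mem dom (Finset.mem_univ Y)),
          hxY, dom Y, isSkeleton_self_of_isConn hb⟩
    _ = αc * ∑ X ∈ (Finset.univ.biUnion dom).powerset.filter (fun X => x ∈ X ∧ ∃ S, IsSkeleton X S),
          Real.exp (-(a * (linSize X : ℝ))) := by rw [Finset.mul_sum]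
    _ ≤ αc * 2 ^ (ν + 1 + 2 ^ ν) :=
        mul_le_mul_of_nonneg_left (sum_exp_neg_mul_linSize_le_const (Finset.univ.biUnion dom) x ha) hαc

variable {Bg : Type} {Ω : Type*}

/-- **(L‴) IN THE LINEAR SIZE ⇒ (L″) WITHOUT `e^{a}` (kernel).**  PER-DOMAIN DECAY of the coefficient tables
`‖c_ω(Y)‖ ≤ αc k·e^{−a·d(dom Y)}` (TYPE: the (2.20) summand «+ Σ_{Y∈𝐃} α₄exp(−δκd_k(Y))» of [II] p. 16 = radius (2.18) × table size
(1.36), `a ↔ δκ`), wall-connectedness of every nonempty domain ([I] p. 257), injectivity of the domain labelling on nonempty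
domains, the ADDITIVE threshold `a ≥ 2^ν·log 2 + log(8ν)` and `αc k·2^(ν+1+2^ν) ≤ lip k` GIVE the pinned scale bound (L″) of
`T4HistoryLipschitzSegment.cubeChart_ne9_and_fadingMemory_of_pinned` at every cube.  Compare `pin_of_domainDecay` (cube-count
currency: `αc k·θ₁ ≤ lip k` with `y₁·e^{Dθ₁} ≤ θ₁`, `y₁ = e^{−a/2^ν}`, `αc ↦ αc·e^{a}`).  (L‴) is displayed, not asserted.
[cite: Balaban1988RG2Cluster, (2.18)-(2.20) p.16, (1.36) p.9, (1.26) p.8; Balaban1987RG1, p.257] -/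
theorem pin_of_linSizeDecay {c : ℕ → ℝ → Bg → Finset (Fin ν → G) → Ω → F → ℂ}
    {dom : ℕ → Finset (Fin ν → G) → F → Finset (Fin ν → G)} {αc lip : ℕ → ℝ} {a : ℝ} (hαc : ∀ k, 0 ≤ αc k)
    (ha : (2:ℝ) ^ ν * Real.log 2 + Real.log (8 * ν) ≤ a) (hliplb : ∀ k, αc k * 2 ^ (ν + 1 + 2 ^ ν) ≤ lip k)
    (hlin : ∀ k s U (γ : Finset (Fin ν → G)) ω Y,
      ‖c k s U γ ω Y‖ ≤ αc k * Real.exp (-(a * (linSize (dom k γ Y) : ℝ))))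
    (hdomconn : ∀ k (γ : Finset (Fin ν → G)) Y, (dom k γ Y).Nonempty →
      ∃ b ∈ dom k γ Y, Polymer.IsConn WallAdj (dom k γ Y) b)
    (hdominj : ∀ k (γ : Finset (Fin ν → G)), Set.InjOn (dom k γ) {Y | (dom k γ Y).Nonempty}) :
    ∀ k s U (γ : Finset (Fin ν → G)) ω, ∀ x ∈ γ,
      ∑ Y ∈ Finset.univ.filter (fun Y => x ∈ dom k γ Y), ‖c k s U γ ω Y‖ ≤ lip k :=
  fun k s U γ ω x _ =>
    (pinnedSum_le_of_linSizeDecay (hαc k) ha (hlin k s U γ ω) (hdomconn k γ) (hdominj k γ) x).trans (hliplb k)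

end Pinned

/-! ## §2 The torus END faces with the lip side in d-currency: E2′ (from E2) and E5″ (from E5) -/

section Torus

variable {ν N : ℕ} {C : Carriers} {D : ℕ}
variable {Bg : Type} {Sp : Type*} [TopologicalSpace Sp] [MeasurableSpace Sp] [OpensMeasurableSpace Sp] {F : Type*}
  [Fintype F] {Ω : Type*} [MeasurableSpace Ω]

/-- **E2′ — NE9 ∧ FADING MEMORY ON A TORUS CUBE CHART, (L‴) IN THE LINEAR SIZE WITH THE PINNED SUMS ALSO IN THE LINEAR SIZE
(kernel end-to-end).**  `T4HistoryLipschitzLinearSize.torus_ne9_and_fadingMemory_of_linSizeDecay` (E2) with its two lip-side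
scalars `hθ₁ : e^{−a/2^ν}·e^{Dθ₁} ≤ θ₁`, `hliplb : α₄(k)·e^{a}·θ₁ ≤ lip k` (cube-count entropy after (2.30)) REPLACED by print's
shape: the ADDITIVE threshold `ha : 2^ν·log 2 + log(8ν) ≤ a` on the (2.18)×(1.36) rate and `hliplb : α₄(k)·2^(ν+1+2^ν) ≤ lip k`
(κ-free constant of (1.26), `NE9LinSizeEntropy`) — NO `e^{a}` reaches `lipbar`.  Every other binder ((A″) still in cube-count
currency `ε k·y^{#γ′}` with `hθ`, `hεθ`, `hκd`) and the conclusion VERBATIM those of E2.  Composition: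
`cubeChart_ne9_and_fadingMemory_of_pinned` ∘ §1 (`wallAdj_eq_torusAdj` is `rfl`).  Nothing of [I]–[III] asserted; rung (B)+1
bookkeeping on a finite torus. [cite: Balaban1988RG2Cluster, (1.26) p.8, (2.18)-(2.20) p.16, (2.30) p.18, (2.41) p.21; Balaban1987RG1, (0.23) p.256, p.257, (1.18) p.263; KoteckyPreiss1986, (1)-(3)] -/
theorem torus_ne9_and_fadingMemory_of_linSizeDecay_pinnedLin (Γ : CubeChart C (Fin ν → ZMod N) (torusAdj ν N) D)
    {ι : Type} {E : Functional C Bg}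
    {W : Set (ℕ → ℝ)} {Adm : Set (Bg → C.Dom → ℝ)} {T : ℕ → (ℕ → ℝ) → (Bg → C.Dom → ℝ) → ι → ℝ}
    {Ψ : ℕ → ℝ → (ι → ℝ) → Bg → C.Dom → ℝ}
    {μ : ℕ → ℝ → Bg → Finset (Fin ν → ZMod N) → Measure Ω} {pre : ℕ → ℝ → Bg → Finset (Fin ν → ZMod N) → Ω → ℂ}
    {c : ℕ → ℝ → Bg → Finset (Fin ν → ZMod N) → Ω → F → ℂ}
    {pt : ℕ → ℝ → Bg → Finset (Fin ν → ZMod N) → Ω → F → Sp} {β : ℕ → Sp → ℝ}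
    {dom : ℕ → Finset (Fin ν → ZMod N) → F → Finset (Fin ν → ZMod N)}
    {lip ε α4 : ℕ → ℝ} {y a₁ d₁ θ κ lipbar ℓ τbar ω a : ℝ} {wt : ℕ → ι → ℝ} {τ : ℕ → ℕ → ℝ} {lam p₀ Nsz : ℕ → ℝ}
    (ρ : ℕ → (ι → ℝ) → (Sp →ᵇ ℂ))
    (h0 : ScaleZeroFree E W) (hAdm : AdmissibleTerms E W Adm) (hres : AdmRestrict Adm)
    (hadd : ChannelAdditive Adm T) (hsum : ChannelStepSum Adm T) (hstep : ChannelSizeAtStepNN Adm T κ wt τ)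
    (hfac : Factorises E W T Ψ) (hlast : LastCouplingLipschitz E W T Ψ κ lam)
    (hρ : ∀ (k : ℕ) (P P' : ι → ℝ) (M : ℝ), (∀ y, |P y - P' y| ≤ wt k y * M) → ‖ρ k P - ρ k P'‖ ≤ M)
    (hΨ : ∀ (k : ℕ) (s : ℝ) (P P' : ι → ℝ) (U : Bg) (X : C.Dom),
      Ψ k s P U X - Ψ k s P' U X =
        (Γ.geom.newTerm (Γ.geom.avgExpLinearAct μ pre fun k s U γ ω => evalFunctional (c k s U γ ω) (pt k s U γ ω))
            k s U X (ρ k P) -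
          Γ.geom.newTerm (Γ.geom.avgExpLinearAct μ pre fun k s U γ ω => evalFunctional (c k s U γ ω) (pt k s U γ ω))
            k s U X (ρ k P')).re)
    (hexpl : ∀ g ∈ W, ∀ (k : ℕ) (P : ι → ℝ) (U : Bg) (X : C.Dom), C.scale X = k + 1 →
      |Ψ k (g k) P U X -
          (Γ.geom.newTerm (Γ.geom.avgExpLinearAct μ pre fun k s U γ ω => evalFunctional (c k s U γ ω) (pt k s U γ ω))
            k (g k) U X (ρ k P)).re| ≤ Real.exp (-(κ * C.d X)) * p₀ k)
    (hbase : ∀ g ∈ W, ∀ (U : Bg) (X : C.Dom), C.scale X = 0 → |E g U X| ≤ Real.exp (-(κ * C.d X)) * Nsz 0)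
    (hNsucc : ∀ j, p₀ j + a₁ ≤ Nsz (j + 1)) (hNnn : ∀ j, 0 ≤ Nsz j)
    (hbox : ∀ (k : ℕ) (P : ι → ℝ), (∀ y, |P y| ≤ wt k y * sizeRadius τ Nsz k) → ∀ x, ‖ρ k P x‖ ≤ β k x)
    (hpre : ∀ k s U γ, AEStronglyMeasurable (pre k s U γ) (μ k s U γ))
    (hc : ∀ k s U γ Y, AEStronglyMeasurable (fun ω => c k s U γ ω Y) (μ k s U γ))
    (hpt : ∀ k s U γ Y, Measurable fun ω => pt k s U γ ω Y) (hlip : ∀ k, 0 < lip k) (hlipb : ∀ k, lip k ≤ lipbar)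
    (hint₀ : ∀ k s U γ, Integrable (fun ω => ‖pre k s U γ ω‖ * Real.exp (boxExponent c pt β k s U γ ω)) (μ k s U γ))
    (hmeet : ∀ k s U (γ : Finset (Fin ν → ZMod N)) ω Y, c k s U γ ω Y ≠ 0 → ∃ x ∈ γ, x ∈ dom k γ Y)
    -- (L‴) decay of the coefficient tables IN THE LINEAR SIZE; the pinned sums (1.26) IN THE LINEAR SIZE: additive threshold,
    -- κ-free constant (REPLACES E2's `hθ₁`, `hliplb : α4·e^{a}·θ₁ ≤ lip`)
    (hα4 : ∀ k, 0 ≤ α4 k) (ha : (2:ℝ) ^ ν * Real.log 2 + Real.log (8 * ν) ≤ a)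
    (hliplb : ∀ k, α4 k * 2 ^ (ν + 1 + 2 ^ ν) ≤ lip k)
    (hlin : ∀ k s U (γ : Finset (Fin ν → ZMod N)) ω Y,
      ‖c k s U γ ω Y‖ ≤ α4 k * Real.exp (-(a * (linSize (dom k γ Y) : ℝ))))
    (hdomconn : ∀ k (γ : Finset (Fin ν → ZMod N)) Y, (dom k γ Y).Nonempty →
      ∃ b ∈ dom k γ Y, Polymer.IsConn (torusAdj ν N) (dom k γ Y) b)
    (hdominj : ∀ k (γ : Finset (Fin ν → ZMod N)), Set.InjOn (dom k γ) {Y | (dom k γ Y).Nonempty})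
    -- (A″) decay of the box majorant, cube-count currency, with its KP scalars (unchanged from E2)
    (hε : ∀ k, 0 ≤ ε k) (hy : 0 ≤ y)
    (hdecay₀ : ∀ g ∈ W, ∀ (k : ℕ) (U : Bg) (X : C.Dom), C.scale X = k + 1 → ∀ γ' ∈ Γ.vol X,
      ∫ ω, ‖pre k (g k) U γ' ω‖ * Real.exp (boxExponent c pt β k (g k) U γ' ω) ∂(μ k (g k) U γ') ≤ ε k * y ^ γ'.card)
    (hθ : 2 * y * Real.exp (a₁ + d₁) * Real.exp (D * θ) ≤ θ) (hεθ : ∀ k, 2 * ε k * θ * ((D : ℝ) + 1) ≤ a₁)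
    (ha₁ : 0 ≤ a₁) (hκ : 0 ≤ κ) (hκd : κ ≤ d₁) (hℓ : 0 ≤ ℓ) (hτbar : 0 ≤ τbar) (hω : 0 ≤ ω)
    (hpos : 0 < ω + 4 * lipbar * a₁ * τbar) (hlam : ∀ k, lam k ≤ ℓ)
    (hτ : ∀ k j, j ≤ k → 0 ≤ τ k j ∧ τ k j ≤ τbar * ω ^ (k - j)) :
    NE9 E W κ (prodModuli ℓ fun _ => ω + 4 * lipbar * a₁ * τbar) ∧
      FadingMemory (ℓ / (ω + 4 * lipbar * a₁ * τbar)) (ω + 4 * lipbar * a₁ * τbar)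
        (prodModuli ℓ fun _ => ω + 4 * lipbar * a₁ * τbar) :=
  cubeChart_ne9_and_fadingMemory_of_pinned Γ ρ h0 hAdm hres hadd hsum hstep hfac hlast hρ hΨ hexpl hbase hNsucc hNnn hbox
    hpre hc hpt hlip hlipb hint₀ hmeet
    (pin_of_linSizeDecay (G := ZMod N) hα4 ha hliplb hlin (fun k γ Y hY => hdomconn k γ Y hY) hdominj)
    hε hy hdecay₀ hθ hεθ ha₁ hκ hκd hℓ hτbar hω hpos hlam hτ

/-- **E5″ — BOTH ACTIVITY-SIDE DECAYS AND THE PINNED SUMS IN BAŁABAN'S LINEAR SIZE (kernel end-to-end).**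
`NE9PrintedMajorantDecay.torus_ne9_and_fadingMemory_of_printedDecay` (E5: (L‴) `hlin` and (A″) `hdecayLin` in d-currency) with
the lip-side scalars `hθ₁`, `hliplb : α₄(k)·e^{a}·θ₁ ≤ lip k` REPLACED by `ha : 2^ν·log 2 + log(8ν) ≤ a`,
`hliplb : α₄(k)·2^(ν+1+2^ν) ≤ lip k` as in E2′; every other binder and the conclusion VERBATIM those of E5.  STILL
CUBE-COUNT on the KP side: `hθ : 2·e^{−a′/2^ν}·e^{a₁+d₁}·e^{Dθ} ≤ θ`, `hεθ : 2·(ε′ k·e^{a′})·θ·(D+1) ≤ a₁`, `hκd : κ ≤ d₁` — i.e.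
the rate division (R) and the `e^{a′}` half of (P) of F-ne9leaf01-1 REMAIN here (their removal = stage B-ii on NE9-F8 part 1b);
the `e^{a}` half of (P) is GONE.  Composition: §2 E2′ ∘ `boxMajorantDecay_of_linSizeDecay` BY NAME.  Nothing of [I]–[III]
asserted; rung (B)+1 bookkeeping on a finite torus. [cite: Balaban1988RG2Cluster, Lemma 3 (2.38) p.20, (2.18)-(2.20) p.16, (2.30) p.18, (1.26) p.8; Balaban1987RG1, (0.23) p.256, p.257, (1.18) p.263] -/
theorem torus_ne9_and_fadingMemory_of_printedDecay_pinnedLin (Γ : CubeChart C (Fin ν → ZMod N) (torusAdj ν N) D)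
    {ι : Type} {E : Functional C Bg}
    {W : Set (ℕ → ℝ)} {Adm : Set (Bg → C.Dom → ℝ)} {T : ℕ → (ℕ → ℝ) → (Bg → C.Dom → ℝ) → ι → ℝ}
    {Ψ : ℕ → ℝ → (ι → ℝ) → Bg → C.Dom → ℝ}
    {μ : ℕ → ℝ → Bg → Finset (Fin ν → ZMod N) → Measure Ω} {pre : ℕ → ℝ → Bg → Finset (Fin ν → ZMod N) → Ω → ℂ}
    {c : ℕ → ℝ → Bg → Finset (Fin ν → ZMod N) → Ω → F → ℂ}
    {pt : ℕ → ℝ → Bg → Finset (Fin ν → ZMod N) → Ω → F → Sp} {β : ℕ → Sp → ℝ}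
    {dom : ℕ → Finset (Fin ν → ZMod N) → F → Finset (Fin ν → ZMod N)}
    {lip ε' α4 : ℕ → ℝ} {a₁ d₁ θ κ lipbar ℓ τbar ω a a' : ℝ} {wt : ℕ → ι → ℝ} {τ : ℕ → ℕ → ℝ} {lam p₀ Nsz : ℕ → ℝ}
    (ρ : ℕ → (ι → ℝ) → (Sp →ᵇ ℂ))
    (h0 : ScaleZeroFree E W) (hAdm : AdmissibleTerms E W Adm) (hres : AdmRestrict Adm)
    (hadd : ChannelAdditive Adm T) (hsum : ChannelStepSum Adm T) (hstep : ChannelSizeAtStepNN Adm T κ wt τ)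
    (hfac : Factorises E W T Ψ) (hlast : LastCouplingLipschitz E W T Ψ κ lam)
    (hρ : ∀ (k : ℕ) (P P' : ι → ℝ) (M : ℝ), (∀ y, |P y - P' y| ≤ wt k y * M) → ‖ρ k P - ρ k P'‖ ≤ M)
    (hΨ : ∀ (k : ℕ) (s : ℝ) (P P' : ι → ℝ) (U : Bg) (X : C.Dom),
      Ψ k s P U X - Ψ k s P' U X =
        (Γ.geom.newTerm (Γ.geom.avgExpLinearAct μ pre fun k s U γ ω => evalFunctional (c k s U γ ω) (pt k s U γ ω))
            k s U X (ρ k P) -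
          Γ.geom.newTerm (Γ.geom.avgExpLinearAct μ pre fun k s U γ ω => evalFunctional (c k s U γ ω) (pt k s U γ ω))
            k s U X (ρ k P')).re)
    (hexpl : ∀ g ∈ W, ∀ (k : ℕ) (P : ι → ℝ) (U : Bg) (X : C.Dom), C.scale X = k + 1 →
      |Ψ k (g k) P U X -
          (Γ.geom.newTerm (Γ.geom.avgExpLinearAct μ pre fun k s U γ ω => evalFunctional (c k s U γ ω) (pt k s U γ ω))
            k (g k) U X (ρ k P)).re| ≤ Real.exp (-(κ * C.d X)) * p₀ k)
    (hbase : ∀ g ∈ W, ∀ (U : Bg) (X : C.Dom), C.scale X = 0 → |E g U X| ≤ Real.exp (-(κ * C.d X)) * Nsz 0)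
    (hNsucc : ∀ j, p₀ j + a₁ ≤ Nsz (j + 1)) (hNnn : ∀ j, 0 ≤ Nsz j)
    (hbox : ∀ (k : ℕ) (P : ι → ℝ), (∀ y, |P y| ≤ wt k y * sizeRadius τ Nsz k) → ∀ x, ‖ρ k P x‖ ≤ β k x)
    (hpre : ∀ k s U γ, AEStronglyMeasurable (pre k s U γ) (μ k s U γ))
    (hc : ∀ k s U γ Y, AEStronglyMeasurable (fun ω => c k s U γ ω Y) (μ k s U γ))
    (hpt : ∀ k s U γ Y, Measurable fun ω => pt k s U γ ω Y) (hlip : ∀ k, 0 < lip k) (hlipb : ∀ k, lip k ≤ lipbar)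
    (hint₀ : ∀ k s U γ, Integrable (fun ω => ‖pre k s U γ ω‖ * Real.exp (boxExponent c pt β k s U γ ω)) (μ k s U γ))
    (hmeet : ∀ k s U (γ : Finset (Fin ν → ZMod N)) ω Y, c k s U γ ω Y ≠ 0 → ∃ x ∈ γ, x ∈ dom k γ Y)
    -- (L‴) in the linear size + the pinned sums in the linear size (lip side, d-currency)
    (hα4 : ∀ k, 0 ≤ α4 k) (ha : (2:ℝ) ^ ν * Real.log 2 + Real.log (8 * ν) ≤ a)
    (hliplb : ∀ k, α4 k * 2 ^ (ν + 1 + 2 ^ ν) ≤ lip k)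
    (hlin : ∀ k s U (γ : Finset (Fin ν → ZMod N)) ω Y,
      ‖c k s U γ ω Y‖ ≤ α4 k * Real.exp (-(a * (linSize (dom k γ Y) : ℝ))))
    (hdomconn : ∀ k (γ : Finset (Fin ν → ZMod N)) Y, (dom k γ Y).Nonempty →
      ∃ b ∈ dom k γ Y, Polymer.IsConn (torusAdj ν N) (dom k γ Y) b)
    (hdominj : ∀ k (γ : Finset (Fin ν → ZMod N)), Set.InjOn (dom k γ) {Y | (dom k γ Y).Nonempty})
    -- (A″) decay of the box majorant IN THE LINEAR SIZE (TYPE (2.38)); KP scalars still cube-count (stage B-ii removes them)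
    (hε' : ∀ k, 0 ≤ ε' k) (ha' : 0 ≤ a')
    (hdecayLin : ∀ g ∈ W, ∀ (k : ℕ) (U : Bg) (X : C.Dom), C.scale X = k + 1 → ∀ γ' ∈ Γ.vol X,
      ∫ ω, ‖pre k (g k) U γ' ω‖ * Real.exp (boxExponent c pt β k (g k) U γ' ω) ∂(μ k (g k) U γ') ≤
        ε' k * Real.exp (-(a' * (linSize γ' : ℝ))))
    (hθ : 2 * Real.exp (-(a' / 2 ^ ν)) * Real.exp (a₁ + d₁) * Real.exp (D * θ) ≤ θ)
    (hεθ : ∀ k, 2 * (ε' k * Real.exp a') * θ * ((D : ℝ) + 1) ≤ a₁)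
    (ha₁ : 0 ≤ a₁) (hκ : 0 ≤ κ) (hκd : κ ≤ d₁) (hℓ : 0 ≤ ℓ) (hτbar : 0 ≤ τbar) (hω : 0 ≤ ω)
    (hpos : 0 < ω + 4 * lipbar * a₁ * τbar) (hlam : ∀ k, lam k ≤ ℓ)
    (hτ : ∀ k j, j ≤ k → 0 ≤ τ k j ∧ τ k j ≤ τbar * ω ^ (k - j)) :
    NE9 E W κ (prodModuli ℓ fun _ => ω + 4 * lipbar * a₁ * τbar) ∧
      FadingMemory (ℓ / (ω + 4 * lipbar * a₁ * τbar)) (ω + 4 * lipbar * a₁ * τbar)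
        (prodModuli ℓ fun _ => ω + 4 * lipbar * a₁ * τbar) :=
  torus_ne9_and_fadingMemory_of_linSizeDecay_pinnedLin Γ ρ h0 hAdm hres hadd hsum hstep hfac hlast hρ hΨ hexpl hbase hNsucc
    hNnn hbox hpre hc hpt hlip hlipb hint₀ hmeet hα4 ha hliplb hlin hdomconn hdominj
    (fun k => mul_nonneg (hε' k) (Real.exp_pos a').le) (Real.exp_pos _).le
    (boxMajorantDecay_of_linSizeDecay Γ hε' ha' hdecayLin) hθ hεθ ha₁ hκ hκd hℓ hτbar hω hpos hlam hτ

end Torus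

end Summit.QuantumFields.BalabanUV.T4Continuum.NE9LinSizePinned

end
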